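import Mathlib
import Summits.SmoothPoincare4.SmoothPoincare4.Theses.CylinderEntropy
import Literature.Geometry.Riemannian.SphericalCylinderEntropy
import Literature.Geometry.Manifold.CylinderSlice

/-!
# Sketch — crux idea `dynamic-certificate` for E = `CylinderEntropy.ThinCrossSectionExists`
(crux stmt-SmoothPoincare4-7633, round 2, ideator 5)

First lemmas of the card, typed over existing declarations (no `sorry`):

* §0  `crux_iff` — E through named pieces (`Iff.rfl`, as in the standing Disproof).
* §1  THE THIN BASIN IS C¹-LARGE (the certificate endgame, SPC4-free, provable given item 7634):
      `GraphEntropyBoundCrude` / `GraphEntropyBound` — a chordal-`L`-Lipschitz graph over the slice has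
      `λ_cyl ≤ (1+L²)²` (Mathlib Lipschitz–Hausdorff comparison + layer cake + `λ_cyl(slice) ≤ 1`), resp.
      `≤ √(1+L²)` (area formula); `lipschitzGraphThin_of_crude` — hence `L ≤ 0.46` (crude) already gives
      `λ_cyl < 4/e`: the late-time leaf of any flow line converging in C¹ to a slice is thin as soon as its
      gradient drops below `0.46` (sharp: `1.079`), long before it is C^∞-close.
* §2  UNIV — the SPC4-free SOURCE of flow lines: `ProductWithLine` (Kirby–Siebenmann in dimension 5 /
      6-dimensional s-cobordism with Wh(ℤ)=0: `M × ℝ ≅ S⁴ × ℝ` for every homotopy 4-sphere) and its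
      cross-section form `PeriodicFoliation` (every homotopy 4-sphere is a leaf of a ℤ-periodic foliation of
      N by cross-sections); `leaf_mem_N`.
* §3  THE SKELETON SHAPE whose proof term does not pass through `SmoothPoincare4` (answer to the round-1
      objection): with the flow notion abstracted as a predicate `Good` on cross-section embeddings,
      `crux_of_certificate : ExistsGood Good → Certificate Good → ThinCrossSectionExists` — the witness is
      the OUTPUT of the certificate (a late-time leaf), not `slice ∘ φ`.  Instantiation of `Good` =
      "the mean curvature flow of `range ι` in N is immortal" (E_imm) or "meets only multiplicity-one neck /
      round singularities" (E_necks) needs the round cylinder packaged as a Riemannian 5-manifold for the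
      tree's `Literature.Geometry.Riemannian.IsClassicalMCF g F ν a b` (definition request D3 of the card).
-/

noncomputable section

set_option linter.dupNamespace false

open scoped BigOperators Topology Manifold MeasureTheory ENNReal NNReal ContDiff ContinuousMap
open Set Function MeasureTheory
open Literature.Geometry.Riemannian.SphericalCylinderEntropy (cylEntropy)
open Literature.Geometry.Manifold.CylinderSlice (padL axis sliceMap range_sliceMap sum_sq_sliceMap
  padL_apply_castSucc padL_apply_last castSucc_ne_five sum_sq_eq_one)

namespace Summit.SmoothPoincare4.SmoothPoincare4.Cruxes.ThinCrossSectionExists.DynamicCertificate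

open Summit.SmoothPoincare4.SmoothPoincare4.Theses.CylinderEntropy (ThinCrossSectionExists
  CylinderRungTwo SliceCalibration)

local notation "E⁶" => EuclideanSpace ℝ (Fin 6)
local notation "E⁵" => EuclideanSpace ℝ (Fin 5)
local notation "E⁴" => EuclideanSpace ℝ (Fin 4)
local notation "𝕊⁴" => (Metric.sphere (0 : EuclideanSpace ℝ (Fin 5)) 1)

/-! ## §0 The crux through named pieces -/

/-- `z ∈ N = S⁴×ℝ ⊂ ℝ⁶`, literally as in the items. -/
def InN (z : E⁶) : Prop := ∑ i : Fin 5, z (Fin.castSucc i) ^ 2 = 1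

/-- "separates the two ends of `N`", literally as in the items. -/
def Separates (A : Set E⁶) : Prop :=
  ∃ R : ℝ, ∀ a b : E⁶, InN a → InN b → a 5 ≤ -R → R ≤ b 5 → ¬ JoinedIn ({z : E⁶ | InN z} \ A) a b

/-- The bubble-sheet threshold `4/e` as typed. -/
def level : ℝ≥0∞ := ENNReal.ofReal (4 / Real.exp 1)

/-- `M` has an end-separating smooth cross-section embedding of typed cylinder entropy `< c`. -/
def CrossSectionBelow (c : ℝ≥0∞) (M : Type) [TopologicalSpace M] [ChartedSpace E⁴ M] : Prop :=
  ∃ ι : M → E⁶, Manifold.IsSmoothEmbedding (𝓡 4) (𝓡 6) ∞ ι ∧ (∀ x, InN (ι x)) ∧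
    Separates (Set.range ι) ∧ cylEntropy (Set.range ι) < c

/-- The crux E is literally "every homotopy 4-sphere is `CrossSectionBelow (4/e)`". -/
theorem crux_iff : ThinCrossSectionExists ↔
    ∀ (M : Type) [TopologicalSpace M] [T2Space M] [SecondCountableTopology M]
      [ChartedSpace E⁴ M] [IsManifold (𝓡 4) ∞ M], M ≃ₕ 𝕊⁴ → CrossSectionBelow level M := Iff.rfl

/-! ## §1 The thin basin is C¹-large: Lipschitz graphs over the slice -/

/-- The graph of `f : S⁴ → ℝ` over the slice, `x ↦ (x, f x) ∈ N ⊂ ℝ⁶`. -/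
def graphMap (f : 𝕊⁴ → ℝ) (x : 𝕊⁴) : E⁶ := padL (x : E⁵) + f x • axis

@[simp] theorem graphMap_apply_castSucc (f : 𝕊⁴ → ℝ) (x : 𝕊⁴) (i : Fin 5) :
    graphMap f x (Fin.castSucc i) = (x : E⁵) i := by
  simp [graphMap, axis, castSucc_ne_five i]

@[simp] theorem graphMap_apply_last (f : 𝕊⁴ → ℝ) (x : 𝕊⁴) : graphMap f x 5 = f x := by
  simp [graphMap, axis]

/-- Graphs lie in `N`. -/
theorem inN_graphMap (f : 𝕊⁴ → ℝ) (x : 𝕊⁴) : InN (graphMap f x) := by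
  simp only [InN, graphMap_apply_castSucc]
  exact sum_sq_eq_one x

/-- The graph map of a chordal-`L`-Lipschitz function is `√(1+L²)`-Lipschitz into `ℝ⁶`
(the only metric input of the crude bound). -/
theorem lipschitzWith_graphMap {f : 𝕊⁴ → ℝ} {L : ℝ≥0} (hf : LipschitzWith L f) :
    LipschitzWith (NNReal.sqrt (1 + L ^ 2)) (graphMap f) := by
  refine LipschitzWith.of_dist_le_mul fun x y => ?_
  have hfxy : dist (f x) (f y) ≤ L * dist x y := hf.dist_le_mul x y
  have hsub : graphMap f x - graphMap f y = padL ((x : E⁵) - (y : E⁵)) + (f x - f y) • axis := by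
    simp only [graphMap, map_sub, sub_smul]; abel
  have hnorm : ‖graphMap f x - graphMap f y‖ ^ 2 = ‖(x : E⁵) - (y : E⁵)‖ ^ 2 + (f x - f y) ^ 2 := by
    rw [hsub, EuclideanSpace.norm_sq_eq, Fin.sum_univ_castSucc, EuclideanSpace.norm_sq_eq]
    congr 1
    · refine Finset.sum_congr rfl fun i _ => ?_
      simp [axis, castSucc_ne_five i]
    · simp [axis, Real.norm_eq_abs, sq_abs]
  have hd : dist x y = ‖(x : E⁵) - (y : E⁵)‖ := by
    rw [Subtype.dist_eq, dist_eq_norm]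
  rw [dist_eq_norm, ← Real.sqrt_sq (norm_nonneg _), hnorm]
  have hL : (0 : ℝ) ≤ L := L.2
  have h1 : (f x - f y) ^ 2 ≤ (L * dist x y) ^ 2 := by
    have : |f x - f y| ≤ L * dist x y := by simpa [Real.dist_eq] using hfxy
    calc (f x - f y) ^ 2 = |f x - f y| ^ 2 := (sq_abs _).symm
      _ ≤ (L * dist x y) ^ 2 := pow_le_pow_left₀ (abs_nonneg _) this 2
  calc Real.sqrt (‖(x : E⁵) - (y : E⁵)‖ ^ 2 + (f x - f y) ^ 2)
      ≤ Real.sqrt ((1 + (L : ℝ) ^ 2) * dist x y ^ 2) := by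
        refine Real.sqrt_le_sqrt ?_
        rw [hd] at h1 ⊢
        nlinarith [h1, sq_nonneg ‖(x : E⁵) - (y : E⁵)‖]
    _ = (NNReal.sqrt (1 + L ^ 2) : ℝ) * dist x y := by
        rw [Real.sqrt_mul (by positivity), Real.sqrt_sq dist_nonneg]
        simp [Real.coe_sqrt, NNReal.coe_add, NNReal.coe_pow]

/-- **CRUDE GRAPH BOUND (provable now, given the `≤ 1` half of item 7634 `SliceCalibration`).**
For a chordal-`L`-Lipschitz `f : S⁴ → ℝ`, `λ_cyl(graph f) ≤ (1+L²)²`: compare the typed kernel area of the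
graph with that of the slice through the same centre — the height Gaussian is `≤ 1` inside `ENNReal.ofReal`,
the spherical factor depends only on the shadow, and `μH⁴(graphMap f '' A) ≤ (√(1+L²))⁴ μH⁴(A)`
(`LipschitzWith.hausdorffMeasure_image_le` + layer cake, exactly as the tree's `GaussianAreaGraphBound`);
finally `λ_cyl(slice) ≤ 1`. Stated as a Prop (first lemma of the certificate endgame). -/
def GraphEntropyBoundCrude : Prop :=
  ∀ (L : ℝ≥0) (f : 𝕊⁴ → ℝ), LipschitzWith L f →
    cylEntropy (Set.range (graphMap f)) ≤ ENNReal.ofReal ((1 + (L : ℝ) ^ 2) ^ 2)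

/-- **SHARP GRAPH BOUND** (area formula: the Jacobian of `x ↦ (x, f x)` is `√(1+|∇f|²) ≤ √(1+L²)`):
`λ_cyl(graph f) ≤ √(1+L²)`; thin as soon as `L < √(16/e² − 1) = 1.079…`. Needs the area formula for
Lipschitz graphs (not in Mathlib); recorded as the target form. -/
def GraphEntropyBound : Prop :=
  ∀ (L : ℝ≥0) (f : 𝕊⁴ → ℝ), LipschitzWith L f →
    cylEntropy (Set.range (graphMap f)) ≤ ENNReal.ofReal (Real.sqrt (1 + (L : ℝ) ^ 2))

/-- Numerical input of the crude thin basin: `(1 + 0.46²)² < 4/e` (`1.2116² = 1.46797 < 1.47151`). -/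
theorem crude_const_lt_level : ENNReal.ofReal ((1 + (0.46 : ℝ) ^ 2) ^ 2) < level := by
  rw [level]
  refine (ENNReal.ofReal_lt_ofReal_iff (by positivity)).mpr ?_
  rw [lt_div_iff₀ (Real.exp_pos 1)]
  have := Real.exp_one_lt_d9
  nlinarith

/-- **The thin basin contains every chordal-`0.46`-Lipschitz graph** (given the crude bound): the
certificate endgame — a flow line needs only to bring ONE leaf into this C¹-ball of radius ~1/2 around
a slice, not to converge. -/
theorem lipschitzGraphThin_of_crude (h : GraphEntropyBoundCrude) {f : 𝕊⁴ → ℝ} {L : ℝ≥0}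
    (hf : LipschitzWith L f) (hL : (L : ℝ) ≤ 0.46) :
    cylEntropy (Set.range (graphMap f)) < level := by
  refine lt_of_le_of_lt (h L f hf) (lt_of_le_of_lt ?_ crude_const_lt_level)
  refine ENNReal.ofReal_le_ofReal ?_
  have hL0 : (0 : ℝ) ≤ L := L.2
  nlinarith [mul_le_mul hL hL hL0 (by norm_num : (0:ℝ) ≤ 0.46)]

/-- Crux-level corollary (the last line of the skeleton): a cross-section embedding of `M` whose IMAGE is a
chordal-`0.46`-Lipschitz graph over the slice witnesses `CrossSectionBelow (4/e) M` — for ANY `M` carrying such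
an embedding (the diffeomorphism type of `M` is never inspected). -/
theorem crossSectionBelow_of_range_eq_graph (h : GraphEntropyBoundCrude)
    {M : Type} [TopologicalSpace M] [ChartedSpace E⁴ M] {ι : M → E⁶}
    (hι : Manifold.IsSmoothEmbedding (𝓡 4) (𝓡 6) ∞ ι) (hN : ∀ x, InN (ι x)) (hsep : Separates (Set.range ι))
    {f : 𝕊⁴ → ℝ} {L : ℝ≥0} (hf : LipschitzWith L f) (hL : (L : ℝ) ≤ 0.46)
    (hrange : Set.range ι = Set.range (graphMap f)) : CrossSectionBelow level M :=
  ⟨ι, hι, hN, hsep, hrange ▸ lipschitzGraphThin_of_crude h hf hL⟩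

/-! ## §2 UNIV — every homotopy 4-sphere is a leaf (the SPC4-free source of flow lines) -/

/-- **UNIV (Kirby–Siebenmann, dimension 5; equivalently Θ₄ʰ = 0 + 6-dimensional s-cobordism with
Wh(ℤ) = 0 for the circle form).** For every homotopy 4-sphere `M` of the summit frame, `M × ℝ` is
diffeomorphic to `S⁴ × ℝ`: a smooth 5-manifold homeomorphic (Freedman × id) to `S⁴ × ℝ ≃ S⁴`, whose smoothings
are classified by `[S⁴, TOP/O] = π₄(TOP/O) = 0`.  SPC4-free; the hub's card `universal-mapping-torus` records the
circle version `M × S¹ ≅ S⁴ × S¹` as folklore. -/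
def ProductWithLine : Prop :=
  ∀ (M : Type) [TopologicalSpace M] [T2Space M] [SecondCountableTopology M]
    [ChartedSpace E⁴ M] [IsManifold (𝓡 4) ∞ M], M ≃ₕ 𝕊⁴ →
    Nonempty ((M × ℝ) ≃ₘ⟮(𝓡 4).prod 𝓘(ℝ, ℝ), (𝓡 4).prod 𝓘(ℝ, ℝ)⟯ (𝕊⁴ × ℝ))

/-- **UNIV in cross-section form: a ℤ-PERIODIC FOLIATION OF `N` WITH LEAF `M`.** Every homotopy 4-sphere
`M` admits a smooth embedding `Φ : M × ℝ → ℝ⁶` onto `N = S⁴×ℝ`, equivariant under the unit vertical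
translation; its leaves `Φ(M × {s})` are pairwise disjoint cross-sections sweeping `N` exactly once per period
(from `ProductWithLine` in its circle form `M × S¹ ≅ S⁴ × S¹`, lifted to the ℤ-covers). This is the card's
source of candidate flow lines and of the leaf-averaged identities. -/
def PeriodicFoliation : Prop :=
  ∀ (M : Type) [TopologicalSpace M] [T2Space M] [SecondCountableTopology M]
    [ChartedSpace E⁴ M] [IsManifold (𝓡 4) ∞ M], M ≃ₕ 𝕊⁴ →
    ∃ Φ : M × ℝ → E⁶, Manifold.IsSmoothEmbedding ((𝓡 4).prod 𝓘(ℝ, ℝ)) (𝓡 6) ∞ Φ ∧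
      Set.range Φ = {z : E⁶ | InN z} ∧ ∀ (x : M) (s : ℝ), Φ (x, s + 1) = Φ (x, s) + axis

/-- Leaves of a periodic foliation lie in `N` (the membership clause of E for the leaf embedding
`x ↦ Φ (x, s)`). -/
theorem leaf_mem_N {M : Type} [TopologicalSpace M] [ChartedSpace E⁴ M] {Φ : M × ℝ → E⁶}
    (hΦ : Set.range Φ = {z : E⁶ | InN z}) (s : ℝ) (x : M) : InN (Φ (x, s)) := by
  have : Φ (x, s) ∈ Set.range Φ := ⟨(x, s), rfl⟩
  rw [hΦ] at this
  exact this

/-! ## §3 The skeleton shape: existence of a GOOD flow line + an SPC4-free CERTIFICATE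

`Good ι` abstracts "the mean curvature flow in N starting at the cross-section `range ι` is immortal"
(E_imm) — or, weaker, "meets only multiplicity-one neck and round singularities" (E_necks).  The certificate
direction is SPC4-free GMT: exact Hamilton monotonicity in N + Lemma NC + only-slices-rest ⇒ the
end-separating piece becomes a `0.46`-Lipschitz graph over a slice at some finite time (§1 then makes it thin),
and it is diffeomorphic to the INITIAL `M` because every neck of a homotopy-sphere flow is separating and the
pinched-off pieces are extinguished convexly (Huisken) — connected sum with standard spheres, never `M ≅ S⁴`.
The hard stub `ExistsGood` is SPC4-strength (card: "costume risk", Barrier note B4), but the composition below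
keeps `SmoothPoincare4` OUT of the proof term: the witness is produced by `Certificate`, not transported. -/

section Skeleton

variable (Good : ∀ {M : Type} [TopologicalSpace M] [ChartedSpace E⁴ M], (M → E⁶) → Prop)

/-- HARD STUB SHAPE (E_imm / E_necks): every homotopy 4-sphere has SOME cross-section embedding (e.g. some
leaf of some periodic foliation in its class, §2) whose flow line is good. -/
def ExistsGood : Prop :=
  ∀ (M : Type) [TopologicalSpace M] [T2Space M] [SecondCountableTopology M]
    [ChartedSpace E⁴ M] [IsManifold (𝓡 4) ∞ M], M ≃ₕ 𝕊⁴ →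
    ∃ ι : M → E⁶, Manifold.IsSmoothEmbedding (𝓡 4) (𝓡 6) ∞ ι ∧ (∀ x, InN (ι x)) ∧
      Separates (Set.range ι) ∧ Good ι

/-- CERTIFICATE SHAPE (SPC4-free analysis): a good flow line from a cross-section of `M` ends, at some
finite time, at a thin cross-section OF THE SAME `M`. -/
def Certificate : Prop :=
  ∀ (M : Type) [TopologicalSpace M] [T2Space M] [SecondCountableTopology M]
    [ChartedSpace E⁴ M] [IsManifold (𝓡 4) ∞ M] (ι : M → E⁶),
    Manifold.IsSmoothEmbedding (𝓡 4) (𝓡 6) ∞ ι → (∀ x, InN (ι x)) → Separates (Set.range ι) →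
      Good ι → CrossSectionBelow level M

/-- **The composition concludes the crux BY NAME and does not mention the summit.** -/
theorem crux_of_certificate (hE : ExistsGood Good) (hC : Certificate Good) : ThinCrossSectionExists := by
  rw [crux_iff]
  intro M _ _ _ _ _ e
  obtain ⟨ι, hι, hN, hsep, hgood⟩ := hE M e
  exact hC M ι hι hN hsep hgood

end Skeleton

end Summit.SmoothPoincare4.SmoothPoincare4.Cruxes.ThinCrossSectionExists.DynamicCertificate

end
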